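import Literature.Probability.RandomPlanarGeometry.SLEKappaRhoStepJets
import HarnessLib

/-!
# [LSW] Lemma 8.9, the deterministic one-step expansion of `log M` and of `M` (raw form)

G. F. Lawler, O. Schramm, W. Werner, *Conformal restriction: the chordal case*, J. Amer. Math.
Soc. **16** (2003) 917–955 (**[LSW]**), §8.4, proof of Lemma 8.9: "Using these expressions in
Itô's formula for `dM_t`, one can now compute the semi-martingale decomposition of `M_t`."

This file assembles the one-step (conditional-increment) substitute for that Itô computation,
deterministically, for one step of the Loewner flow (increment driver `U` on `[0, u]`,
`x = U_u`, slid hull `B'`) and a displacement `a ≤ 0` of the force point from `o` to `y = o + a`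
(new relative position `y − x`): with `E = starMap B`, `E₁ = starMap B'`, `D = glueDrift B ρ₀`,

  `Δ := ell E₁ ρ 0 (y − x) − ell E ρ 0 o = ℓ₁ x + (m₁ a + ½ ℓ₂ x² + u·λ) + err`,
  `|exp Δ − 1 − (ℓ₁ x + m₁ a + ½ ℓ₂ x² + u λ + ½ ℓ₁² x²)| ≤ rawErr`            (`norm_exp_oneStep_sub_le`),

where `ℓ₁, ℓ₂, m₁` are the `x`- and `y`-derivatives of `ell E ρ` at `(0, o)`
(`SLEKappaRhoLogGamma`), `λ = lam E D ρ 0 o` (`SLEKappaRhoLambda`), and `rawErr` is an explicit sum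
of the remainders of: the perturbation of the three logarithms (`StepJets`: `e₁, e₂, e₃`), the
Lipschitz continuity of `lam`, the Cauchy–Taylor expansion of `ell`, and the exponentiation. The
absorption of `rawErr` into `K·(uη_s + u² + |x|³ + a² + |a||x| + u|a| + u|x|)` and the real form
with `oneSidedM` are in the sequel. No named facts; definitions are explicit error expressions.

## References

* [LSW] §8.4 proof of Lemma 8.9; §5 (5.1). [LawlerSchrammWerner2003Restriction]
-/

noncomputable section

open Set Filter Metric Complex
open scoped Topology Real NNReal
open UpperHalfPlane (upperHalfPlaneSet)

namespace Literature.Probability.RandomPlanarGeometry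

namespace SLEKappaRho

open Loewner Literature.Analysis.Complex

variable {B : Set ℂ} {ρ₀ δ η R : ℝ} {U : ℝ≥0 → ℝ} {u : ℝ≥0} {S : ℝ}

/-- The radius `r₁ = min (ρ₀/48) (η/6)` of the far Cauchy balls. [folklore] -/
def farRadius (ρ₀ η : ℝ) : ℝ := min (ρ₀ / 48) (η / 6)

/-- `0 < farRadius`. [folklore] -/
theorem farRadius_pos (hρ₀ : 0 < ρ₀) (hη : 0 < η) : 0 < farRadius ρ₀ η := lt_min (by positivity) (by positivity)
/-- `farRadius ≤ ρ₀/48`. [folklore] -/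
theorem farRadius_le (ρ₀ η : ℝ) : farRadius ρ₀ η ≤ ρ₀ / 48 := min_le_left _ _
/-- `3 · farRadius < η/4` scale comparison. [folklore] -/
theorem three_farRadius_lt (hη : 0 < η) (ρ₀ : ℝ) : 3 * farRadius ρ₀ η < η := by
  have := min_le_right (ρ₀ / 48) (η / 6); rw [farRadius]; linarith

/-- **The total error of the three jet perturbations** (a bound valid in all cases near/far):
`3 stepErr₁ + 2(u(farC₁η_s + farC₂u))/r₁ + 9(25000u(η_sρ₀+u)/(dρ₀³) + u(farC₁η_s + farC₂u))/ρ₀`.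
[folklore] -/
def stepErrAll (d δ η ρ₀ ηs u : ℝ) : ℝ :=
  3 * stepErr₁ d ρ₀ ηs u +
    2 * (u * (farC₁ d ρ₀ (δ * ρ₀ / 16) * ηs + farC₂ d ρ₀ (δ * ρ₀ / 16) (farRadius ρ₀ η) * u)) / farRadius ρ₀ η +
    9 * (25000 * u * (ηs * ρ₀ + u) / (d * ρ₀ ^ 3) +
      u * (farC₁ d ρ₀ (δ * ρ₀ / 16) * ηs + farC₂ d ρ₀ (δ * ρ₀ / 16) (farRadius ρ₀ η) * u)) / ρ₀

section Step

variable (hB : IsStarHull B) (hρ₀ : 0 < ρ₀) (hBρ : Disjoint (ball (0 : ℂ) (8 * ρ₀)) B)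
  (hJ : JetControl (starMap B) δ η R)
  (hU : Continuous U) (hU0 : U 0 = 0) (hu : 0 < u) (hS : ∀ v : ℝ≥0, v ≤ u → |U v| ≤ S)
  (hηs : stepSize S u ≤ starDeriv B * ρ₀ / 1000)
  (hm : 8 * stepSize S u ≤ δ * ρ₀ / 16)
  (hηsη : stepSize S u < η / 8)
  (hclear : ∀ t : ℝ, t ∈ Icc (-R - 2) 0 → ρ₀ / 8 ≤ |t| → Disjoint (ball (t : ℂ) ρ₀) B)

/-- Nonnegativity of the pieces of `stepErrAll`. [folklore] -/
theorem stepErr_pieces_nonneg (hd : 0 < starDeriv B) (hδ : 0 < δ) (hη : 0 < η) (hρ₀ : 0 < ρ₀) (hηs0 : 0 ≤ stepSize S u) :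
    0 ≤ stepErr₁ (starDeriv B) ρ₀ (stepSize S u) u ∧
    0 ≤ u * (farC₁ (starDeriv B) ρ₀ (δ * ρ₀ / 16) * stepSize S u +
      farC₂ (starDeriv B) ρ₀ (δ * ρ₀ / 16) (farRadius ρ₀ η) * u) ∧
    0 ≤ 25000 * u * (stepSize S u * ρ₀ + u) / (starDeriv B * ρ₀ ^ 3) := by
  have hr := farRadius_pos hρ₀ hη
  have hm₀ : 0 < δ * ρ₀ / 16 := by positivity
  have hC : 0 ≤ farCrude (starDeriv B) ρ₀ (δ * ρ₀ / 16) := by unfold farCrude; positivity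
  have h1 : 0 ≤ farC₁ (starDeriv B) ρ₀ (δ * ρ₀ / 16) := by unfold farC₁; positivity
  have h2 : 0 ≤ farC₂ (starDeriv B) ρ₀ (δ * ρ₀ / 16) (farRadius ρ₀ η) := by unfold farC₂; positivity
  refine ⟨by unfold stepErr₁; positivity, by positivity, by positivity⟩

include hB hρ₀ hBρ hJ hU hU0 hu hS hηs hm hclear in
/-- **The three jet perturbations and their errors.** With `x = U_u`, `y` real in `[−R−2, 0]`,
`E₁ = starMap B'`: `sᵢ − 2u gᵢ` is bounded by `stepErrAll` for
`(s₁, s₂, s₃) = (E₁'(0) − E'(x), E₁'(y − x) − E'(y), DQ E₁ 0 (y − x) − DQ E x y)` and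
`(g₁, g₂, g₃) = (D'(x), D'(y), DQ D x y)`.
[cite: LawlerSchrammWerner2003Restriction, proof of Lemma 8.9 (the displayed differentials)] -/
theorem norm_jets_sub_le {y : ℝ} (hy : y ∈ Icc (-R - 2) 0) :
    ‖(deriv (starMap (slidHull U B u)) 0 - deriv (starMap B) (U u)) - 2 * (u : ℂ) * deriv (glueDrift B ρ₀) (U u)‖ ≤
        stepErrAll (starDeriv B) δ η ρ₀ (stepSize S u) u ∧
      ‖(deriv (starMap (slidHull U B u)) (y - U u) - deriv (starMap B) y) - 2 * (u : ℂ) * deriv (glueDrift B ρ₀) y‖ ≤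
        stepErrAll (starDeriv B) δ η ρ₀ (stepSize S u) u ∧
      ‖(DQ (starMap (slidHull U B u)) 0 (y - U u) - DQ (starMap B) (U u) y) - 2 * (u : ℂ) * DQ (glueDrift B ρ₀) (U u) y‖ ≤
        stepErrAll (starDeriv B) δ η ρ₀ (stepSize S u) u := by
  obtain ⟨hd0, -, -⟩ := starDeriv_spec hB
  obtain ⟨hUu, hη1, hη0⟩ := abs_driver_le hB hu hS hρ₀ hηs
  obtain ⟨-, hB'⟩ := isStarHull_slidHull_canonical hB hU hU0 hS hρ₀ hBρ hηs
  have hη := hJ.η_pos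
  have hr₁ := farRadius_pos hρ₀ hη
  have hr₁' := farRadius_le ρ₀ η
  have hr₁η := three_farRadius_lt hη ρ₀
  obtain ⟨hE1, hEfar, hEsup⟩ := stepErr_pieces_nonneg (S := S) (u := u) hd0 hJ.δ_pos hη hρ₀ hη0.le
  have hxn : ‖((U u : ℝ) : ℂ)‖ ≤ stepSize S u := by rw [norm_real, Real.norm_eq_abs]; exact hUu
  have hx8 : ((U u : ℝ) : ℂ) ∈ ball (0 : ℂ) (ρ₀ / 8) := mem_ball_zero_iff.2 (by linarith)
  -- `e₁`
  have e1 := norm_e₁_le hB hρ₀ hBρ hU hU0 hu hS hηs (z := ((U u : ℝ) : ℂ)) (by linarith)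
  rw [sub_self] at e1
  have hAll : ∀ {t : ℝ}, t ≤ 3 * stepErr₁ (starDeriv B) ρ₀ (stepSize S u) u → t ≤ stepErrAll (starDeriv B) δ η ρ₀ (stepSize S u) u := by
    intro t ht; unfold stepErrAll
    have : 0 ≤ 2 * (u * (farC₁ (starDeriv B) ρ₀ (δ * ρ₀ / 16) * stepSize S u +
        farC₂ (starDeriv B) ρ₀ (δ * ρ₀ / 16) (farRadius ρ₀ η) * u)) / farRadius ρ₀ η := by positivity
    have : 0 ≤ 9 * (25000 * u * (stepSize S u * ρ₀ + u) / (starDeriv B * ρ₀ ^ 3) +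
        u * (farC₁ (starDeriv B) ρ₀ (δ * ρ₀ / 16) * stepSize S u +
          farC₂ (starDeriv B) ρ₀ (δ * ρ₀ / 16) (farRadius ρ₀ η) * u)) / ρ₀ := by positivity
    linarith
  refine ⟨hAll (by linarith), ?_, ?_⟩
  · -- `e₂`: near or far
    rcases lt_or_ge |y| (ρ₀ / 8) with hnear | hfar
    · have hy8 : ‖(y : ℂ)‖ ≤ ρ₀ / 8 := by rw [norm_real, Real.norm_eq_abs]; exact hnear.le
      have e2 := norm_e₁_le hB hρ₀ hBρ hU hU0 hu hS hηs hy8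
      exact hAll (by linarith)
    · have e2 := norm_e₂_far_le hB hρ₀ hBρ hJ hU hU0 hu hS hηs hy hfar (hclear y hy hfar) hr₁ hr₁' hr₁η hm
      unfold stepErrAll
      have : 0 ≤ 9 * (25000 * u * (stepSize S u * ρ₀ + u) / (starDeriv B * ρ₀ ^ 3) +
          u * (farC₁ (starDeriv B) ρ₀ (δ * ρ₀ / 16) * stepSize S u +
            farC₂ (starDeriv B) ρ₀ (δ * ρ₀ / 16) (farRadius ρ₀ η) * u)) / ρ₀ := by positivity
      linarith
  · -- `e₃`: the identity `DQ E₁ 0 (y - x) = DQ E x y + DQ st x y`, then near or far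
    have hident : DQ (starMap (slidHull U B u)) 0 (y - U u) - DQ (starMap B) (U u) y =
        DQ (starStep B U u) (U u) y := by
      rcases eq_or_ne ((y : ℂ) - U u) 0 with h0 | hne
      · -- diagonal: `y = x`
        have hyx : (y : ℂ) = U u := sub_eq_zero.1 h0
        rw [h0, DQ_same, hyx, DQ_same, DQ_same]
        have hx2 : ((U u : ℝ) : ℂ) ∈ ball (0 : ℂ) (ρ₀ / 2) := ball_subset_ball (by linarith) hx8
        have hst := hasDerivAt_starStep_near hB hρ₀ hBρ hU hU0 hu hS hηs hx2
        have hxJ : ((U u : ℝ) : ℂ) ∈ jetBox R η := by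
          rw [← hyx]; exact ofReal_mem_jetBox hJ ⟨hy.1, hy.2.trans hη.le⟩
        have hE : HasDerivAt (starMap B) (deriv (starMap B) (U u)) (U u) :=
          (hJ.differentiableOn.differentiableAt ((isOpen_jetBox R η).mem_nhds hxJ)).hasDerivAt
        have h := hasDerivAt_starMap_slidHull hB' (w := 0) (by rw [zero_add]; exact hst) (by rw [zero_add]; exact hE)
        rw [h.deriv, hst.deriv]
        ring
      · have hne' : ((U u : ℝ) : ℂ) ≠ y := fun h ↦ hne (by rw [h, sub_self])
        rw [DQ_of_ne _ (Ne.symm hne), starMap_zero hB', DQ_of_ne _ hne', DQ_of_ne _ hne',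
          starMap_slidHull_eq hB' ((y : ℂ) - U u), sub_add_cancel]
        field_simp [sub_ne_zero.2 hne', sub_ne_zero.2 (Ne.symm hne')]
        ring
    rw [hident]
    rcases lt_or_ge |y| (ρ₀ / 8) with hnear | hfar
    · have hy8 : (y : ℂ) ∈ ball (0 : ℂ) (ρ₀ / 8) := mem_ball_zero_iff.2 (by rw [norm_real, Real.norm_eq_abs]; exact hnear)
      have e3 := norm_e₃_near_le hB hρ₀ hBρ hU hU0 hu hS hηs hx8 hy8
      exact hAll e3
    · have e3 := norm_e₃_far_le hB hρ₀ hBρ hJ hU hU0 hu hS hηs hxn hy hfar (hclear y hy hfar) hr₁ hr₁' hr₁η hm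
      unfold stepErrAll
      have : 0 ≤ 2 * (u * (farC₁ (starDeriv B) ρ₀ (δ * ρ₀ / 16) * stepSize S u +
          farC₂ (starDeriv B) ρ₀ (δ * ρ₀ / 16) (farRadius ρ₀ η) * u)) / farRadius ρ₀ η := by positivity
      linarith

end Step

/-! ### The exponential model from the four pieces (pure algebra) -/

/-- The raw error `(B_L + B_Q + B_e)³ + B_e + ½ (B_Q + B_e)(2B_L + B_Q + B_e)`. [folklore] -/
def rawErr (BL BQ Be : ℝ) : ℝ := (BL + BQ + Be) ^ 3 + Be + 2⁻¹ * ((BQ + Be) * (2 * BL + (BQ + Be)))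

/-- `rawErr` is monotone in its three (nonnegative) arguments. [folklore] -/
theorem rawErr_mono {BL BQ Be BL' BQ' Be' : ℝ} (h0L : 0 ≤ BL) (h0Q : 0 ≤ BQ) (h0e : 0 ≤ Be)
    (hL : BL ≤ BL') (hQ : BQ ≤ BQ') (he : Be ≤ Be') : rawErr BL BQ Be ≤ rawErr BL' BQ' Be' := by
  unfold rawErr
  have h3 : (BL + BQ + Be) ^ 3 ≤ (BL' + BQ' + Be') ^ 3 := pow_le_pow_left₀ (by positivity) (by linarith) 3
  have h4 : (BQ + Be) * (2 * BL + (BQ + Be)) ≤ (BQ' + Be') * (2 * BL' + (BQ' + Be')) :=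
    mul_le_mul (by linarith) (by linarith) (by positivity) (by linarith)
  linarith

/-- **The exponential model from the four pieces.** If `ell₁ − ell(x,y) − FO`, `FO − u·λ(x,y)`,
`u(λ(x,y) − λ(0,o))` and `ell(x,y) − ell(0,o) − (ℓ₁x + m₁a + ½ℓ₂x²)` are bounded by
`T₁, …, T₄` with `ΣTᵢ ≤ B_e`, `|ℓ₁x| ≤ B_L`, `|m₁a + ½ℓ₂x² + uλ(0,o)| ≤ B_Q` and
`B_L + B_Q + B_e ≤ 1`, then
`|exp(ell₁ − ell(0,o)) − 1 − (ℓ₁x + m₁a + ½ℓ₂x² + uλ(0,o) + ½ℓ₁²x²)| ≤ rawErr B_L B_Q B_e`.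
[cite: LawlerSchrammWerner2003Restriction, proof of Lemma 8.9 (Itô's formula for dM)] -/
theorem norm_exp_model_of_pieces {ell₁ ellxy ell0 FO lamxy lam0 L1 M1 L2 x a : ℂ} {u : ℝ}
    {BL BQ Be T1 T2 T3 T4 : ℝ}
    (hT1 : ‖ell₁ - ellxy - FO‖ ≤ T1) (hT2 : ‖FO - (u : ℂ) * lamxy‖ ≤ T2) (hT3 : ‖(u : ℂ) * (lamxy - lam0)‖ ≤ T3)
    (hT4 : ‖ellxy - ell0 - (L1 * x + M1 * a + 2⁻¹ * L2 * x ^ 2)‖ ≤ T4)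
    (hBe : T1 + T2 + T3 + T4 ≤ Be) (hL : ‖L1 * x‖ ≤ BL) (hQ : ‖M1 * a + 2⁻¹ * L2 * x ^ 2 + (u : ℂ) * lam0‖ ≤ BQ)
    (h1 : BL + BQ + Be ≤ 1) :
    ‖Complex.exp (ell₁ - ell0) - 1 - (L1 * x + M1 * a + 2⁻¹ * L2 * x ^ 2 + (u : ℂ) * lam0 + 2⁻¹ * (L1 * x) ^ 2)‖ ≤
      rawErr BL BQ Be := by
  obtain ⟨err, herr_def⟩ : ∃ err : ℂ, err = (ell₁ - ellxy - FO) + (FO - (u : ℂ) * lamxy) + (u : ℂ) * (lamxy - lam0) +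
    (ellxy - ell0 - (L1 * x + M1 * a + 2⁻¹ * L2 * x ^ 2)) := ⟨_, rfl⟩
  have herr : ‖err‖ ≤ Be := by
    rw [herr_def]
    have := norm_add_le ((ell₁ - ellxy - FO) + (FO - (u : ℂ) * lamxy) + (u : ℂ) * (lamxy - lam0))
      (ellxy - ell0 - (L1 * x + M1 * a + 2⁻¹ * L2 * x ^ 2))
    have := norm_add₃_le (a := ell₁ - ellxy - FO) (b := FO - (u : ℂ) * lamxy) (c := (u : ℂ) * (lamxy - lam0))
    linarith
  have h0e : 0 ≤ Be := (norm_nonneg _).trans herr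
  have hΔ : ell₁ - ell0 = L1 * x + (M1 * a + 2⁻¹ * L2 * x ^ 2 + (u : ℂ) * lam0) + err := by
    rw [herr_def]; ring
  have h0L : 0 ≤ BL := (norm_nonneg _).trans hL
  have h0Q : 0 ≤ BQ := (norm_nonneg _).trans hQ
  have hΔ1 : ‖ell₁ - ell0‖ ≤ BL + BQ + Be := by
    rw [hΔ]
    have := norm_add₃_le (a := L1 * x) (b := M1 * a + 2⁻¹ * L2 * x ^ 2 + (u : ℂ) * lam0) (c := err)
    linarith
  have h := norm_exp_sub_model_le hΔ (hΔ1.trans h1)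
  have hshape : L1 * x + (M1 * a + 2⁻¹ * L2 * x ^ 2 + (u : ℂ) * lam0) + 2⁻¹ * (L1 * x) ^ 2 =
      L1 * x + M1 * a + 2⁻¹ * L2 * x ^ 2 + (u : ℂ) * lam0 + 2⁻¹ * (L1 * x) ^ 2 := by ring
  rw [hshape] at h
  refine h.trans ?_
  have hQe : ‖M1 * a + 2⁻¹ * L2 * x ^ 2 + (u : ℂ) * lam0 + err‖ ≤ BQ + Be :=
    (norm_add_le _ _).trans (add_le_add hQ herr)
  unfold rawErr
  have hn := norm_nonneg (M1 * a + 2⁻¹ * L2 * x ^ 2 + (u : ℂ) * lam0 + err)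
  have hc : ‖ell₁ - ell0‖ ^ 3 ≤ (BL + BQ + Be) ^ 3 := by gcongr
  have hp : ‖M1 * a + 2⁻¹ * L2 * x ^ 2 + (u : ℂ) * lam0 + err‖ * (2 * ‖L1 * x‖ + ‖M1 * a + 2⁻¹ * L2 * x ^ 2 + (u : ℂ) * lam0 + err‖) ≤
      (BQ + Be) * (2 * BL + (BQ + Be)) := by gcongr
  linarith

/-! ### The explicit bounds of the one step -/

/-- `5/8 + |b| + |c|`. [folklore] -/
def kbc (ρ : ℝ) : ℝ := 5 / 8 + |expB ρ| + |expC ρ|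

/-- `0 < kbc`. [folklore] -/
theorem kbc_pos (ρ : ℝ) : 0 < kbc ρ := by unfold kbc; positivity

/-- The bound `B_L = (2M_ℓ/η)|x|` of `|ℓ₁x|`. [folklore] -/
def bndL (Me η X : ℝ) : ℝ := 2 * Me / η * X

/-- The bound `B_Q = (2M_ℓ/η)|a| + ½(8M_ℓ/η²)x² + uΛ` of `|m₁a + ½ℓ₂x² + uλ|`. [folklore] -/
def bndQ (Me Λ η X A u : ℝ) : ℝ := 2 * Me / η * A + 2⁻¹ * (8 * Me / η ^ 2) * X ^ 2 + u * Λ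

/-- The bound `B_e` of the error `err`: perturbation of the logarithms (`2k·3σ²/δ²`), the expansion
errors (`kE/δ`), the Lipschitz displacement of `λ` (`u(16Λ/η)(|x| + |a|)`) and the Taylor remainder
of `ell`. [folklore] -/
def bndErr (k Me Λ η δ σ Ea X A u : ℝ) : ℝ :=
  2 * k * (3 * σ ^ 2) / δ ^ 2 + k * Ea / δ + u * (16 * Λ / η) * (X + A) +
    Me * (16 * X ^ 3 / η ^ 3 + 8 * X * A / η ^ 2 + 16 * X ^ 2 * A / η ^ 3 + 8 * A ^ 2 / η ^ 2)

section Step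

variable (hB : IsStarHull B) (hρ₀ : 0 < ρ₀) (hBρ : Disjoint (ball (0 : ℂ) (8 * ρ₀)) B)
  (hJ : JetControl (starMap B) δ η R)
  (hU : Continuous U) (hU0 : U 0 = 0) (hu : 0 < u) (hS : ∀ v : ℝ≥0, v ≤ u → |U v| ≤ S)
  (hηs : stepSize S u ≤ starDeriv B * ρ₀ / 1000)
  (hm : 8 * stepSize S u ≤ δ * ρ₀ / 16)
  (hηsη : stepSize S u < η / 8)
  (hclear : ∀ t : ℝ, t ∈ Icc (-R - 2) 0 → ρ₀ / 8 ≤ |t| → Disjoint (ball (t : ℂ) ρ₀) B)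

include hB hρ₀ hBρ hJ hU hU0 hu hS hηs hm hηsη hclear in
/-- **[LSW, Lemma 8.9: the one-step expansion of `M`, raw deterministic form].** With
`E = starMap B`, `E₁ = starMap B'` (`B'` the hull slid along `U` on `[0,u]`), `x = U_u`, `o ∈ [−R, 0]`,
`a ∈ (−η/8, 0]`, `y = o + a`, `ℓ₁, ℓ₂, m₁` the jets of `ell E ρ` at `(0, o)`, `λ = lam E D ρ 0 o`
(`D = glueDrift B ρ₀`), and the smallness conditions `σ ≤ δ/2`, `B_L + B_Q + B_e ≤ 1`:

  `|exp(ell E₁ ρ 0 (y − x) − ell E ρ 0 o) − 1 − (ℓ₁x + m₁a + ½ℓ₂x² + uλ + ½ℓ₁²x²)| ≤ rawErr B_L B_Q B_e`.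

This is the deterministic content of "using these expressions in Itô's formula for `dM_t`": the
conditional increment of `M = exp(ell)` over one cell, to second order, with explicit remainders.
[cite: LawlerSchrammWerner2003Restriction, §8.4 proof of Lemma 8.9] -/
theorem norm_exp_oneStep_sub_le (ρ : ℝ) {o a : ℝ} (ho : o ∈ Icc (-R) 0) (ha0 : a ≤ 0) (haη : |a| < η / 8)
    (hsm₁ : 16 * u * glueDriftBound ρ₀ δ / η + stepErrAll (starDeriv B) δ η ρ₀ (stepSize S u) u ≤ δ / 2)
    (hsm₂ : bndL (ellBound ρ δ) η |U u| +
        bndQ (ellBound ρ δ) (lamBound ρ δ η (glueDriftBound ρ₀ δ)) η |U u| |a| u +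
        bndErr (kbc ρ) (ellBound ρ δ) (lamBound ρ δ η (glueDriftBound ρ₀ δ)) η δ
          (16 * u * glueDriftBound ρ₀ δ / η + stepErrAll (starDeriv B) δ η ρ₀ (stepSize S u) u)
          (stepErrAll (starDeriv B) δ η ρ₀ (stepSize S u) u) |U u| |a| u ≤ 1) :
    ‖Complex.exp (ell (starMap (slidHull U B u)) ρ 0 (((o + a : ℝ) : ℂ) - (U u : ℝ)) - ell (starMap B) ρ 0 o) - 1 -
        (deriv (fun x ↦ ell (starMap B) ρ x o) 0 * (U u : ℝ) + deriv (fun y ↦ ell (starMap B) ρ 0 y) o * a +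
          2⁻¹ * iteratedDeriv 2 (fun x ↦ ell (starMap B) ρ x o) 0 * (U u : ℝ) ^ 2 +
          (u : ℂ) * lam (starMap B) (glueDrift B ρ₀) ρ 0 o +
          2⁻¹ * (deriv (fun x ↦ ell (starMap B) ρ x o) 0 * (U u : ℝ)) ^ 2)‖ ≤
      rawErr (bndL (ellBound ρ δ) η |U u|)
        (bndQ (ellBound ρ δ) (lamBound ρ δ η (glueDriftBound ρ₀ δ)) η |U u| |a| u)
        (bndErr (kbc ρ) (ellBound ρ δ) (lamBound ρ δ η (glueDriftBound ρ₀ δ)) η δ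
          (16 * u * glueDriftBound ρ₀ δ / η + stepErrAll (starDeriv B) δ η ρ₀ (stepSize S u) u)
          (stepErrAll (starDeriv B) δ η ρ₀ (stepSize S u) u) |U u| |a| u) := by
  -- names
  set E := starMap B with hE
  set E₁ := starMap (slidHull U B u) with hE₁
  set D := glueDrift B ρ₀ with hD
  set Mg := glueDriftBound ρ₀ δ with hMg
  set Ea := stepErrAll (starDeriv B) δ η ρ₀ (stepSize S u) u with hEa
  set σ := 16 * u * Mg / η + Ea with hσ
  set x : ℂ := ((U u : ℝ) : ℂ) with hx
  set y : ℝ := o + a with hy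
  have hη := hJ.η_pos
  have hη1 := hJ.η_le_one
  have hδ := hJ.δ_pos
  have hR := hJ.R_nonneg
  obtain ⟨hUu, hη1', hη0⟩ := abs_driver_le hB hu hS hρ₀ hηs
  have hDD : DriftData D η R Mg := driftData_glueDrift hB hρ₀ hBρ hJ
  have hMg0 : 0 ≤ Mg := hDD.M_nonneg
  have haη' : |a| ≤ 1 := by linarith
  have hyI : y ∈ Icc (-R - 2) 0 := ⟨by rw [hy]; have := neg_abs_le a; linarith [ho.1], by rw [hy]; linarith [ho.2]⟩
  have hxn : ‖x‖ = |U u| := by rw [hx, norm_real, Real.norm_eq_abs]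
  have hxη : ‖x‖ < η / 8 := by rw [hxn]; linarith
  have han : ‖(a : ℂ)‖ = |a| := by rw [norm_real, Real.norm_eq_abs]
  -- memberships
  have hxJ : x ∈ jetBox R η := innerBox_subset_jetBox hη hη1 (ball_zero_subset_innerBox hR hη1 (mem_ball_zero_iff.2 (by linarith)))
  have hxI : x ∈ innerBox R η := ball_zero_subset_innerBox hR hη1 (mem_ball_zero_iff.2 (by linarith))
  have hyI' : (y : ℂ) ∈ innerBox R η :=
    ball_subset_innerBox hη1 (y₀ := y) ⟨hyI.1, by linarith [hyI.2]⟩ (mem_ball_self (by positivity))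
  have hyJ : (y : ℂ) ∈ jetBox R η := innerBox_subset_jetBox hη hη1 hyI'
  have h0I : (0 : ℂ) ∈ innerBox R η := ball_zero_subset_innerBox hR hη1 (mem_ball_self (by positivity))
  have hoI : (o : ℂ) ∈ innerBox R η :=
    ball_subset_innerBox hη1 (y₀ := o) ⟨by linarith [ho.1], by linarith [ho.2]⟩ (mem_ball_self (by positivity))
  -- the jets and their perturbations
  obtain ⟨e1, e2, e3⟩ := norm_jets_sub_le hB hρ₀ hBρ hJ hU hU0 hu hS hηs hm hclear hyI
  set p₁ := deriv E x with hp₁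
  set p₂ := deriv E y with hp₂
  set p₃ := DQ E x y with hp₃
  set g₁ := deriv D x with hg₁
  set g₂ := deriv D y with hg₂
  set g₃ := DQ D x y with hg₃
  set s₁ := deriv E₁ 0 - p₁ with hs₁
  set s₂ := deriv E₁ (y - x) - p₂ with hs₂
  set s₃ := DQ E₁ 0 (y - x) - p₃ with hs₃
  have hre₁ : δ ≤ p₁.re := hJ.le_re_deriv x hxJ
  have hre₂ : δ ≤ p₂.re := hJ.le_re_deriv y hyJ
  have hre₃ : δ ≤ p₃.re := (le_re_DQ_and_norm_DQ_le hJ hxJ hyJ).1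
  have hgb₁ : ‖g₁‖ ≤ 8 * Mg / η := hDD.norm_deriv_le hη hη1 hxI
  have hgb₂ : ‖g₂‖ ≤ 8 * Mg / η := hDD.norm_deriv_le hη hη1 hyI'
  have hgb₃ : ‖g₃‖ ≤ 8 * Mg / η := norm_DQ_drift_le hDD hη hη1 hxI hyI'
  have hu0 : (0 : ℝ) ≤ u := u.2
  have hun : ‖((u : ℝ) : ℂ)‖ = u := by rw [norm_real, Real.norm_eq_abs, abs_of_nonneg hu0]
  have h2u : ‖(2 : ℂ) * (u : ℂ)‖ = 2 * u := by rw [norm_mul, Complex.norm_ofNat, hun]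
  have hsb : ∀ {s g : ℂ}, ‖s - 2 * (u : ℂ) * g‖ ≤ Ea → ‖g‖ ≤ 8 * Mg / η → ‖s‖ ≤ σ := by
    intro s g hs hg
    have h1 : ‖s‖ ≤ ‖s - 2 * (u : ℂ) * g‖ + ‖2 * (u : ℂ) * g‖ := norm_le_norm_sub_add s _
    have h2 : ‖2 * (u : ℂ) * g‖ ≤ 2 * u * (8 * Mg / η) := by
      rw [norm_mul, h2u]; gcongr
    have h3 : 2 * u * (8 * Mg / η) = 16 * u * Mg / η := by ring
    rw [hσ]; linarith
  have hsσ₁ : ‖s₁‖ ≤ σ := hsb e1 hgb₁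
  have hsσ₂ : ‖s₂‖ ≤ σ := hsb e2 hgb₂
  have hsσ₃ : ‖s₃‖ ≤ σ := hsb e3 hgb₃
  have hσδ : σ ≤ δ / 2 := hsm₁
  -- (T1) perturbation of the logarithms
  have hell₁ : ell E₁ ρ 0 (y - x) = (5 / 8 : ℂ) * Complex.log (p₁ + s₁) + (expB ρ : ℂ) * Complex.log (p₂ + s₂) +
      (expC ρ : ℂ) * Complex.log (p₃ + s₃) := by
    have h1 : p₁ + s₁ = deriv E₁ 0 := by rw [hs₁]; ring
    have h2 : p₂ + s₂ = deriv E₁ (y - x) := by rw [hs₂]; ring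
    have h3 : p₃ + s₃ = DQ E₁ 0 (y - x) := by rw [hs₃]; ring
    rw [h1, h2, h3, ell]
  have hellxy : ell E ρ x y = (5 / 8 : ℂ) * Complex.log p₁ + (expB ρ : ℂ) * Complex.log p₂ + (expC ρ : ℂ) * Complex.log p₃ := rfl
  set FO := (5 / 8 : ℂ) * (s₁ / p₁) + (expB ρ : ℂ) * (s₂ / p₂) + (expC ρ : ℂ) * (s₃ / p₃) with hFO
  have T1 : ‖ell E₁ ρ 0 (y - x) - ell E ρ x y - FO‖ ≤ 2 * kbc ρ * (3 * σ ^ 2) / δ ^ 2 := by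
    rw [hell₁, hellxy, hFO]
    refine (norm_ell_args_perturb_le ρ hδ hre₁ hre₂ hre₃ (hsσ₁.trans hσδ) (hsσ₂.trans hσδ) (hsσ₃.trans hσδ)).trans ?_
    rw [kbc]
    have hσ0 : 0 ≤ σ := (norm_nonneg _).trans hsσ₁
    have : ‖s₁‖ ^ 2 + ‖s₂‖ ^ 2 + ‖s₃‖ ^ 2 ≤ 3 * σ ^ 2 := by
      nlinarith [norm_nonneg s₁, norm_nonneg s₂, norm_nonneg s₃, pow_le_pow_left₀ (norm_nonneg _) hsσ₁ 2,
        pow_le_pow_left₀ (norm_nonneg _) hsσ₂ 2, pow_le_pow_left₀ (norm_nonneg _) hsσ₃ 2]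
    have hk : 0 ≤ 2 * (5 / 8 + |expB ρ| + |expC ρ|) := by positivity
    rw [mul_div_assoc, mul_div_assoc]
    exact mul_le_mul_of_nonneg_left (div_le_div_of_nonneg_right this (by positivity)) hk
  -- (T2) the first-order terms are `u λ(x, y)` up to the expansion errors
  have T2 : ‖FO - (u : ℂ) * lam E D ρ x y‖ ≤ kbc ρ * Ea / δ := by
    have hs₁' : s₁ = 2 * (u : ℝ) * deriv D x + (s₁ - 2 * (u : ℂ) * g₁) := by rw [hg₁]; ring
    have hs₂' : s₂ = 2 * (u : ℝ) * deriv D y + (s₂ - 2 * (u : ℂ) * g₂) := by rw [hg₂]; ring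
    have hs₃' : s₃ = 2 * (u : ℝ) * DQ D x y + (s₃ - 2 * (u : ℂ) * g₃) := by rw [hg₃]; ring
    have h := norm_first_order_sub_lam_le (D := D) hJ ρ hxJ hyJ (u := (u : ℝ)) e1 e2 e3
    rw [← hs₁', ← hs₂', ← hs₃'] at h
    rw [hFO, kbc]
    exact h
  -- (T3) Lipschitz displacement of `λ`
  have hoη2 : o ∈ Icc (-R - 2) (η / 2) := ⟨by linarith [ho.1], by linarith [ho.2]⟩
  have T3 : ‖(u : ℂ) * (lam E D ρ x y - lam E D ρ 0 o)‖ ≤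
      u * (16 * lamBound ρ δ η Mg / η) * (|U u| + |a|) := by
    have hya : (y : ℂ) - o = a := by rw [hy]; push_cast; ring
    have hy4 : (y : ℂ) ∈ ball (o : ℂ) (η / 4) := by
      rw [mem_ball, dist_eq_norm, hya, han]; linarith
    have hy8 : (y : ℂ) ∈ ball (o : ℂ) (η / 8) := by
      rw [mem_ball, dist_eq_norm, hya, han]; exact haη
    have hl := norm_lam_sub_lam_left_le hJ hDD ρ hoη2 hy4 (mem_ball_zero_iff.2 hxη) (mem_ball_self (by positivity))
    have hr := norm_lam_sub_lam_right_le hJ hDD ρ hoη2 (x := 0) (mem_ball_self (by positivity)) hy8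
      (mem_ball_self (by positivity))
    rw [sub_zero, hxn] at hl
    rw [hya, han] at hr
    have hsplit : lam E D ρ x y - lam E D ρ 0 o = (lam E D ρ x y - lam E D ρ 0 y) + (lam E D ρ 0 y - lam E D ρ 0 o) := by ring
    have hn : ‖lam E D ρ x y - lam E D ρ 0 o‖ ≤ 16 * lamBound ρ δ η Mg / η * |U u| + 16 * lamBound ρ δ η Mg / η * |a| := by
      rw [hsplit]; exact (norm_add_le _ _).trans (add_le_add hl hr)
    rw [norm_mul, hun]
    calc (u : ℝ) * ‖lam E D ρ x y - lam E D ρ 0 o‖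
        ≤ u * (16 * lamBound ρ δ η Mg / η * |U u| + 16 * lamBound ρ δ η Mg / η * |a|) :=
          mul_le_mul_of_nonneg_left hn hu0
      _ = _ := by ring
  -- (T4) Taylor expansion of `ell`
  have hoη : o ∈ Icc (-R - 2) η := ⟨hoη2.1, hoη2.2.trans (by linarith)⟩
  have hya' : ((y : ℝ) : ℂ) = (o : ℂ) + (a : ℂ) := by rw [hy]; push_cast; ring
  have T4 : ‖ell E ρ x y - ell E ρ 0 o -
      (deriv (fun x ↦ ell E ρ x o) 0 * x + deriv (fun y ↦ ell E ρ 0 y) o * a +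
        2⁻¹ * iteratedDeriv 2 (fun x ↦ ell E ρ x o) 0 * x ^ 2)‖ ≤
      ellBound ρ δ * (16 * |U u| ^ 3 / η ^ 3 + 8 * |U u| * |a| / η ^ 2 + 16 * |U u| ^ 2 * |a| / η ^ 3 +
        8 * |a| ^ 2 / η ^ 2) := by
    have h := norm_ell_sub_ell_sub_le hJ ρ hoη (x := x) (a := (a : ℂ)) (by linarith) (by rw [han]; linarith)
    rw [hxn, han] at h
    rw [hya']
    exact h
  -- bounds on `L` and `Q`
  obtain ⟨hℓ₁, hℓ₂, hm₁⟩ := norm_coeff_le hJ ρ hoη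
  have hMe := (ellBound_pos ρ δ).le
  have hL : ‖deriv (fun x ↦ ell E ρ x o) 0 * x‖ ≤ bndL (ellBound ρ δ) η |U u| := by
    rw [norm_mul, hxn, bndL]; gcongr
  have hlam0 : ‖lam E D ρ 0 o‖ ≤ lamBound ρ δ η Mg := norm_lam_le hJ hDD ρ h0I hoI
  have hQ : ‖deriv (fun y ↦ ell E ρ 0 y) o * a + 2⁻¹ * iteratedDeriv 2 (fun x ↦ ell E ρ x o) 0 * x ^ 2 +
      (u : ℂ) * lam E D ρ 0 o‖ ≤ bndQ (ellBound ρ δ) (lamBound ρ δ η Mg) η |U u| |a| u := by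
    have q1 : ‖deriv (fun y ↦ ell E ρ 0 y) o * a‖ ≤ 2 * ellBound ρ δ / η * |a| := by
      rw [norm_mul, han]; exact mul_le_mul_of_nonneg_right hm₁ (abs_nonneg a)
    have q2 : ‖(2 : ℂ)⁻¹ * iteratedDeriv 2 (fun x ↦ ell E ρ x o) 0 * x ^ 2‖ ≤
        2⁻¹ * (8 * ellBound ρ δ / η ^ 2) * |U u| ^ 2 := by
      rw [norm_mul, norm_mul, norm_inv, Complex.norm_ofNat, norm_pow, hxn]
      gcongr
    have q3 : ‖(u : ℂ) * lam E D ρ 0 o‖ ≤ u * lamBound ρ δ η Mg := by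
      rw [norm_mul, hun]; exact mul_le_mul_of_nonneg_left hlam0 hu0
    rw [bndQ]
    exact norm_add₃_le.trans (by linarith)
  -- assemble
  have key := norm_exp_model_of_pieces (lam0 := lam E D ρ 0 o) T1 T2 T3 T4 (le_of_eq ?_) hL hQ hsm₂
  · exact key
  · rw [bndErr]

end Step

end SLEKappaRho

end Literature.Probability.RandomPlanarGeometry

end
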